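import Literature.GroupTheory.FiniteAbelian.IndependentGenerators
import HarnessLib

/-!
# A `τ`-adapted character with prescribed kernel

Pure algebra behind McCallum's Prop. 3.1 in *kernel form* (McCallum 1991, §3, PDF p. 280:
*"Let `φ ∈ Hom(C, E_{p^M})` … there exist infinitely many primes `l` such that `φ = φ_{Frob(λ)}`"*):
to realise a prescribed subgroup `K` as the kernel of a localisation map one needs a homomorphism
`φ : G → E_{p^M}^{+} ⊕ E_{p^M}^{-}` with `ker φ = K` mapping `τ`-eigenvectors of sign `±` into the
line spanned by the eigenvector `e_±`. This exists as soon as `K` is `τ`-stable of *eigen-corank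
at most one*: `G = K + ℤg₊ + ℤg₋` with `τ g_± = ±g_±` (`2` invertible, `G` killed by `p^M`,
`e_±` of order exactly `p^M`, `ℤe₊ ∩ ℤe₋ = 0`):

* `exists_addMonoidHom_ker_eq_of_involution`.

Used by `Literature/NumberTheory/EllipticCurves/HeegnerPointsKolyvaginPrimaryCebotarevKernelProofs`
(Čebotarev for Kolyvagin primes, kernel form). No definition and no named fact.

## References

* W. G. McCallum, *Kolyvagin's work on Shafarevich–Tate groups*, LMS Lecture Note Ser. 153
  (1991), 295–316, §3 Prop. 3.1 and (2) (PDF pp. 279–280). [McCallumLMS1991]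
-/

namespace Literature.GroupTheory.FiniteAbelian

universe u v

variable {G : Type u} [AddCommGroup G] {Y : Type v} [AddCommGroup Y]

/-- An element killed by `p^M` but not by `p^{M-1}` has order exactly `p^M`. [folklore] -/
private theorem addOrderOf_eq_prime_pow_of_ne {p M : ℕ} (hp : p.Prime) {y : Y}
    (hy : ((p : ℤ) ^ M) • y = 0) (hy' : ((p : ℤ) ^ (M - 1)) • y ≠ 0) : addOrderOf y = p ^ M := by
  have hdvd : addOrderOf y ∣ p ^ M := by
    apply addOrderOf_dvd_of_nsmul_eq_zero
    rw [← natCast_zsmul]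
    exact_mod_cast hy
  obtain ⟨b, hbM, hb⟩ := (Nat.dvd_prime_pow hp).mp hdvd
  rw [hb]
  rcases Nat.lt_or_ge b M with hlt | hge
  · exfalso
    apply hy'
    have h1 : addOrderOf y ∣ p ^ (M - 1) := hb ▸ Nat.pow_dvd_pow p (Nat.le_sub_one_of_lt hlt)
    have h2 := addOrderOf_dvd_iff_nsmul_eq_zero.mp h1
    rw [← natCast_zsmul] at h2
    exact_mod_cast h2
  · rw [le_antisymm hbM hge]

/-- A hom out of the cyclic group `ℤq` (of order `p^a ∣ p^M`) onto `ℤ(p^{M-a} y)`, injective when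
`y` has order exactly `p^M`. [folklore] -/
private theorem exists_addMonoidHom_zmultiples_injective {p M : ℕ} (hp : p.Prime) (q : G)
    (hq : ((p : ℤ) ^ M) • q = 0) (y : Y) (hy : ((p : ℤ) ^ M) • y = 0)
    (hy' : ((p : ℤ) ^ (M - 1)) • y ≠ 0) :
    ∃ χ : AddSubgroup.zmultiples q →+ Y, (∀ z, χ z ∈ AddSubgroup.zmultiples y) ∧
      ∀ z, χ z = 0 → z = 0 := by
  classical
  -- `ord q = p^a`, `a ≤ M`
  have hdvd : addOrderOf q ∣ p ^ M := by
    apply addOrderOf_dvd_of_nsmul_eq_zero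
    rw [← natCast_zsmul]
    exact_mod_cast hq
  obtain ⟨a, haM, ha⟩ := (Nat.dvd_prime_pow hp).mp hdvd
  -- `ℤq ≃ ℤ/p^a`
  have hgen : ∀ z : AddSubgroup.zmultiples q, z ∈ AddSubgroup.zmultiples
      (⟨q, AddSubgroup.mem_zmultiples q⟩ : AddSubgroup.zmultiples q) := by
    rintro ⟨z, hz⟩
    obtain ⟨k, rfl⟩ := AddSubgroup.mem_zmultiples_iff.mp hz
    exact AddSubgroup.mem_zmultiples_iff.mpr ⟨k, Subtype.ext (by simp)⟩
  have hcard : Nat.card (AddSubgroup.zmultiples q) = p ^ a := by rw [Nat.card_zmultiples, ha]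
  let e := zmodAddEquivOfGenerator hgen hcard
  -- `ℤ/p^a → Y`, `1 ↦ p^{M-a} y`
  have hkill : (zmultiplesHom Y (((p : ℤ) ^ (M - a)) • y)) (p ^ a : ℕ) = 0 := by
    rw [zmultiplesHom_apply, smul_smul, ← Nat.cast_pow, ← Nat.cast_mul, ← pow_add,
      Nat.add_sub_cancel' haM, Nat.cast_pow, hy]
  let χ₀ : ZMod (p ^ a) →+ Y := ZMod.lift (p ^ a) ⟨zmultiplesHom Y (((p : ℤ) ^ (M - a)) • y), hkill⟩
  have hχ₀ : ∀ i : ℤ, χ₀ (i : ZMod (p ^ a)) = (i * (p : ℤ) ^ (M - a)) • y := fun i ↦ by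
    simp only [χ₀, ZMod.lift_coe, zmultiplesHom_apply, smul_smul]
  refine ⟨χ₀.comp e.symm.toAddMonoidHom, fun z ↦ ?_, fun z hz ↦ ?_⟩
  · obtain ⟨k, rfl⟩ := AddSubgroup.mem_zmultiples_iff.mp (hgen z)
    rw [AddMonoidHom.comp_apply, AddEquiv.coe_toAddMonoidHom,
      zmodAddEquivOfGenerator_symm_apply_zsmul, hχ₀]
    exact AddSubgroup.mem_zmultiples_iff.mpr ⟨_, rfl⟩
  · obtain ⟨k, rfl⟩ := AddSubgroup.mem_zmultiples_iff.mp (hgen z)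
    rw [AddMonoidHom.comp_apply, AddEquiv.coe_toAddMonoidHom,
      zmodAddEquivOfGenerator_symm_apply_zsmul, hχ₀] at hz
    -- `p^M ∣ k p^{M-a}`, hence `p^a ∣ k`, hence `k • q = 0`
    have h1 : ((p : ℤ) ^ M) ∣ k * (p : ℤ) ^ (M - a) := by
      have := addOrderOf_dvd_iff_zsmul_eq_zero.mpr hz
      rw [addOrderOf_eq_prime_pow_of_ne hp hy hy'] at this
      exact_mod_cast this
    have h2 : ((p : ℤ) ^ a) ∣ k := by
      have : ((p : ℤ) ^ M) = (p : ℤ) ^ a * (p : ℤ) ^ (M - a) := by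
        rw [← pow_add, Nat.add_sub_cancel' haM]
      rw [this] at h1
      exact (mul_dvd_mul_iff_right (pow_ne_zero _ (by exact_mod_cast hp.ne_zero))).mp h1
    obtain ⟨k', rfl⟩ := h2
    apply Subtype.ext
    rw [AddSubgroupClass.coe_zsmul, ZeroMemClass.coe_zero, mul_comm, mul_smul, ← Nat.cast_pow,
      natCast_zsmul, ← ha, addOrderOf_nsmul_eq_zero, smul_zero]

/-- **A `τ`-adapted character with prescribed kernel** (the algebra of McCallum's Prop. 3.1 in
kernel form). Let `G` be an abelian group killed by `p^M` on which `2` is invertible, `τ` an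
endomorphism of `G` (an involution, in the application), `K` a `τ`-stable subgroup with `G = K + ℤg₁ + ℤg₂` for eigenvectors
`τ g₁ = g₁`, `τ g₂ = -g₂`, and `y₁, y₂ ∈ Y` elements of order exactly `p^M` spanning independent
lines. Then there is `φ : G →+ Y` with `ker φ = K`, `φ(G^+) ⊆ ℤy₁`, `φ(G^-) ⊆ ℤy₂`.
[cite: McCallumLMS1991, Prop. 3.1 (proof), (2)] -/
theorem exists_addMonoidHom_ker_eq_of_involution {p M : ℕ} (hp : p.Prime)
    (hG : ∀ g : G, ((p : ℤ) ^ M) • g = 0) (τ : G →+ G)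
    {u : ℤ} (hu : ∀ g : G, (2 * u) • g = g)
    (K : AddSubgroup G) (hK : ∀ g ∈ K, τ g ∈ K) (g₁ g₂ : G) (hg₁ : τ g₁ = g₁)
    (hg₂ : τ g₂ = -g₂) (hgen : ∀ g, ∃ k ∈ K, ∃ a b : ℤ, g = k + a • g₁ + b • g₂)
    (y₁ y₂ : Y) (hy₁ : ((p : ℤ) ^ M) • y₁ = 0) (hy₁' : ((p : ℤ) ^ (M - 1)) • y₁ ≠ 0)
    (hy₂ : ((p : ℤ) ^ M) • y₂ = 0) (hy₂' : ((p : ℤ) ^ (M - 1)) • y₂ ≠ 0)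
    (hind : ∀ a b : ℤ, a • y₁ + b • y₂ = 0 → a • y₁ = 0 ∧ b • y₂ = 0) :
    ∃ φ : G →+ Y, (∀ g, φ g = 0 ↔ g ∈ K) ∧ (∀ g, τ g = g → φ g ∈ AddSubgroup.zmultiples y₁) ∧
      (∀ g, τ g = -g → φ g ∈ AddSubgroup.zmultiples y₂) := by
  classical
  -- ### the quotient `Q = G/K`, its involution and the two eigen-projections
  have hKK : K ≤ K.comap τ := fun g hg ↦ hK g hg
  let τQ : G ⧸ K →+ G ⧸ K := QuotientAddGroup.map K K τ hKK
  have hτQ : ∀ g : G, τQ (QuotientAddGroup.mk g) = QuotientAddGroup.mk (τ g) := fun g ↦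
    QuotientAddGroup.map_mk K K τ hKK g
  have huQ : ∀ q : G ⧸ K, (2 * u) • q = q := fun q ↦ by
    induction q using QuotientAddGroup.induction_on with
    | H g => rw [← QuotientAddGroup.mk_zsmul, hu]
  let πp : G ⧸ K →+ G ⧸ K := AddMonoidHom.mk' (fun q ↦ u • (q + τQ q)) fun a b ↦ by
    simp only [map_add]; module
  let πm : G ⧸ K →+ G ⧸ K := AddMonoidHom.mk' (fun q ↦ u • (q - τQ q)) fun a b ↦ by
    simp only [map_add]; module
  have hπp : ∀ q, πp q = u • (q + τQ q) := fun q ↦ rfl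
  have hπm : ∀ q, πm q = u • (q - τQ q) := fun q ↦ rfl
  have hq₁ : τQ (QuotientAddGroup.mk g₁) = QuotientAddGroup.mk g₁ := by rw [hτQ, hg₁]
  have hq₂ : τQ (QuotientAddGroup.mk g₂) = -QuotientAddGroup.mk g₂ := by
    rw [hτQ, hg₂, QuotientAddGroup.mk_neg]
  have hgenQ : ∀ q : G ⧸ K, ∃ a b : ℤ,
      q = a • QuotientAddGroup.mk g₁ + b • QuotientAddGroup.mk g₂ := by
    intro q
    induction q using QuotientAddGroup.induction_on with
    | H g =>
      obtain ⟨k, hk, a, b, rfl⟩ := hgen g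
      refine ⟨a, b, ?_⟩
      rw [QuotientAddGroup.mk_add, QuotientAddGroup.mk_add, (QuotientAddGroup.eq_zero_iff k).mpr hk,
        zero_add, QuotientAddGroup.mk_zsmul, QuotientAddGroup.mk_zsmul]
  have hπp_val : ∀ a b : ℤ, πp (a • QuotientAddGroup.mk g₁ + b • QuotientAddGroup.mk g₂) =
      a • QuotientAddGroup.mk g₁ := fun a b ↦ by
    rw [hπp, map_add, map_zsmul, map_zsmul, hq₁, hq₂]
    linear_combination (norm := module) huQ (a • QuotientAddGroup.mk (s := K) g₁)
  have hπm_val : ∀ a b : ℤ, πm (a • QuotientAddGroup.mk g₁ + b • QuotientAddGroup.mk g₂) =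
      b • QuotientAddGroup.mk g₂ := fun a b ↦ by
    rw [hπm, map_add, map_zsmul, map_zsmul, hq₁, hq₂]
    linear_combination (norm := module) huQ (b • QuotientAddGroup.mk (s := K) g₂)
  have hπp_mem : ∀ q, πp q ∈ AddSubgroup.zmultiples (QuotientAddGroup.mk (s := K) g₁) := by
    intro q
    obtain ⟨a, b, rfl⟩ := hgenQ q
    rw [hπp_val]
    exact AddSubgroup.zsmul_mem _ (AddSubgroup.mem_zmultiples _) a
  have hπm_mem : ∀ q, πm q ∈ AddSubgroup.zmultiples (QuotientAddGroup.mk (s := K) g₂) := by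
    intro q
    obtain ⟨a, b, rfl⟩ := hgenQ q
    rw [hπm_val]
    exact AddSubgroup.zsmul_mem _ (AddSubgroup.mem_zmultiples _) b
  have hπsum : ∀ q, πp q + πm q = q := fun q ↦ by
    rw [hπp, hπm]
    linear_combination (norm := module) huQ q
  -- ### the cyclic characters
  have hM₁ : ((p : ℤ) ^ M) • QuotientAddGroup.mk (s := K) g₁ = 0 := by
    rw [← QuotientAddGroup.mk_zsmul, hG, QuotientAddGroup.mk_zero]
  have hM₂ : ((p : ℤ) ^ M) • QuotientAddGroup.mk (s := K) g₂ = 0 := by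
    rw [← QuotientAddGroup.mk_zsmul, hG, QuotientAddGroup.mk_zero]
  obtain ⟨χ₁, hχ₁, hχ₁inj⟩ := exists_addMonoidHom_zmultiples_injective hp _ hM₁ y₁ hy₁ hy₁'
  obtain ⟨χ₂, hχ₂, hχ₂inj⟩ := exists_addMonoidHom_zmultiples_injective hp _ hM₂ y₂ hy₂ hy₂'
  let ψ₁ : G ⧸ K →+ Y := χ₁.comp (πp.codRestrict _ hπp_mem)
  let ψ₂ : G ⧸ K →+ Y := χ₂.comp (πm.codRestrict _ hπm_mem)
  let φ : G →+ Y := (ψ₁ + ψ₂).comp (QuotientAddGroup.mk' K)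
  have hφ : ∀ g, φ g = χ₁ ⟨πp (QuotientAddGroup.mk g), hπp_mem _⟩ +
      χ₂ ⟨πm (QuotientAddGroup.mk g), hπm_mem _⟩ := fun g ↦ rfl
  refine ⟨φ, fun g ↦ ⟨fun h0 ↦ ?_, fun hg ↦ ?_⟩, fun g hg ↦ ?_, fun g hg ↦ ?_⟩
  · -- `φ g = 0 ⟹ g ∈ K`
    rw [hφ] at h0
    obtain ⟨a, ha⟩ := AddSubgroup.mem_zmultiples_iff.mp (hχ₁ ⟨_, hπp_mem (QuotientAddGroup.mk g)⟩)
    obtain ⟨b, hb⟩ := AddSubgroup.mem_zmultiples_iff.mp (hχ₂ ⟨_, hπm_mem (QuotientAddGroup.mk g)⟩)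
    rw [← ha, ← hb] at h0
    obtain ⟨ha0, hb0⟩ := hind a b h0
    have h1 : πp (QuotientAddGroup.mk g) = 0 :=
      congrArg Subtype.val (hχ₁inj _ (by rw [← ha, ha0]))
    have h2 : πm (QuotientAddGroup.mk g) = 0 :=
      congrArg Subtype.val (hχ₂inj _ (by rw [← hb, hb0]))
    rw [← QuotientAddGroup.eq_zero_iff, ← hπsum (QuotientAddGroup.mk g), h1, h2, add_zero]
  · -- `g ∈ K ⟹ φ g = 0`
    change (ψ₁ + ψ₂) (QuotientAddGroup.mk g) = 0
    rw [(QuotientAddGroup.eq_zero_iff g).mpr hg, map_zero]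
  · -- `τ g = g ⟹ φ g ∈ ℤy₁`
    have h2 : πm (QuotientAddGroup.mk g) = 0 := by
      rw [hπm, hτQ, hg, sub_self, smul_zero]
    have : (πm.codRestrict _ hπm_mem) (QuotientAddGroup.mk g) = 0 := Subtype.ext h2
    rw [hφ]
    change χ₁ _ + χ₂ ((πm.codRestrict _ hπm_mem) (QuotientAddGroup.mk g)) ∈ _
    rw [this, map_zero, add_zero]
    exact hχ₁ _
  · -- `τ g = -g ⟹ φ g ∈ ℤy₂`
    have h1 : πp (QuotientAddGroup.mk g) = 0 := by
      rw [hπp, hτQ, hg, QuotientAddGroup.mk_neg, add_neg_cancel, smul_zero]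
    have : (πp.codRestrict _ hπp_mem) (QuotientAddGroup.mk g) = 0 := Subtype.ext h1
    rw [hφ]
    change χ₁ ((πp.codRestrict _ hπp_mem) (QuotientAddGroup.mk g)) + χ₂ _ ∈ _
    rw [this, map_zero, zero_add]
    exact hχ₂ _

/-- **Independent generating family of eigenvectors.** For an involution `τ` of a finite abelian
group on which `2` is invertible, `G = G⁺ ⊕ G⁻` and a union of independent generating families of
`G^±` (from `exists_indep_generators`) is an independent generating family of `τ`-eigenvectors of
`G` (McCallum's independent eigenclasses `c₁, …, c_r`, Cor. 3.2).
[cite: McCallumLMS1991, Cor. 3.2, §5 p. 311] -/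
theorem exists_eigen_indep_generators [Finite G] (τ : G →+ G) (hτ : ∀ g, τ (τ g) = g)
    {u : ℤ} (hu : ∀ g : G, (2 * u) • g = g) :
    ∃ (ι : Type) (_ : Fintype ι) (xs : ι → G) (ν : ι → ℤ), (∀ i, ν i = 1 ∨ ν i = -1) ∧
      (∀ i, τ (xs i) = ν i • xs i) ∧
      (∀ a : ι → ℤ, ∑ i, a i • xs i = 0 → ∀ i, (addOrderOf (xs i) : ℤ) ∣ a i) ∧
      ∀ g, ∃ a : ι → ℤ, g = ∑ i, a i • xs i := by
  classical
  -- the eigenspaces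
  let Gp : AddSubgroup G := (τ - AddMonoidHom.id G).ker
  let Gm : AddSubgroup G := (τ + AddMonoidHom.id G).ker
  have hGp : ∀ g, g ∈ Gp ↔ τ g = g := fun g ↦ by
    rw [AddMonoidHom.mem_ker, AddMonoidHom.sub_apply, AddMonoidHom.id_apply, sub_eq_zero]
  have hGm : ∀ g, g ∈ Gm ↔ τ g = -g := fun g ↦ by
    rw [AddMonoidHom.mem_ker, AddMonoidHom.add_apply, AddMonoidHom.id_apply]
    exact ⟨fun h ↦ eq_neg_of_add_eq_zero_left h, fun h ↦ by rw [h, neg_add_cancel]⟩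
  have hdisj : ∀ g, τ g = g → τ g = -g → g = 0 := fun g h1 h2 ↦ by
    have h3 : (2 : ℤ) • g = 0 := by rw [two_zsmul]; nth_rw 1 [← h1]; rw [h2, neg_add_cancel]
    rw [← hu g, mul_comm, mul_zsmul, h3, zsmul_zero]
  obtain ⟨ιp, _, gp, hgpind, hgpgen⟩ := exists_indep_generators (G := Gp)
  obtain ⟨ιm, _, gm, hgmind, hgmgen⟩ := exists_indep_generators (G := Gm)
  refine ⟨ιp ⊕ ιm, inferInstance, Sum.elim (fun i ↦ (gp i : G)) (fun j ↦ (gm j : G)),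
    Sum.elim (fun _ ↦ 1) (fun _ ↦ -1), ?_, ?_, fun a ha ↦ ?_, fun g ↦ ?_⟩
  · rintro (i | j) <;> simp
  · rintro (i | j)
    · simpa using (hGp _).mp (gp i).2
    · simpa using (hGm _).mp (gm j).2
  · -- independence: the `+` and `-` parts vanish separately
    rw [Fintype.sum_sum_type] at ha
    simp only [Sum.elim_inl, Sum.elim_inr] at ha
    have hP : (∑ i, a (Sum.inl i) • (gp i : G)) ∈ Gp :=
      Gp.sum_mem fun i _ ↦ Gp.zsmul_mem (gp i).2 _
    have hM : (∑ j, a (Sum.inr j) • (gm j : G)) ∈ Gm :=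
      Gm.sum_mem fun j _ ↦ Gm.zsmul_mem (gm j).2 _
    have hP0 : ∑ i, a (Sum.inl i) • (gp i : G) = 0 := by
      have hneg : ∑ i, a (Sum.inl i) • (gp i : G) = -∑ j, a (Sum.inr j) • (gm j : G) :=
        eq_neg_of_add_eq_zero_left ha
      refine hdisj _ ((hGp _).mp hP) ?_
      rw [hneg, map_neg, (hGm _).mp hM, neg_neg]
    have hM0 : ∑ j, a (Sum.inr j) • (gm j : G) = 0 := by rwa [hP0, zero_add] at ha
    have hP0' : ∑ i, a (Sum.inl i) • gp i = 0 :=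
      Subtype.ext (by simpa only [AddSubgroup.val_finsetSum, AddSubgroupClass.coe_zsmul,
        ZeroMemClass.coe_zero] using hP0)
    have hM0' : ∑ j, a (Sum.inr j) • gm j = 0 :=
      Subtype.ext (by simpa only [AddSubgroup.val_finsetSum, AddSubgroupClass.coe_zsmul,
        ZeroMemClass.coe_zero] using hM0)
    rintro (i | j)
    · rw [Sum.elim_inl, AddSubgroup.addOrderOf_coe]
      exact hgpind _ hP0' i
    · rw [Sum.elim_inr, AddSubgroup.addOrderOf_coe]
      exact hgmind _ hM0' j
  · -- generation: `g = u(g + τg) + u(g - τg)`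
    have hp_mem : u • (g + τ g) ∈ Gp := by
      rw [hGp, map_zsmul, map_add, hτ, add_comm]
    have hm_mem : u • (g - τ g) ∈ Gm := by
      rw [hGm, map_zsmul, map_sub, hτ, ← smul_neg, neg_sub]
    obtain ⟨c, hc⟩ := hgpgen ⟨_, hp_mem⟩
    obtain ⟨d, hd⟩ := hgmgen ⟨_, hm_mem⟩
    refine ⟨Sum.elim c d, ?_⟩
    rw [Fintype.sum_sum_type]
    simp only [Sum.elim_inl, Sum.elim_inr]
    have hc' : u • (g + τ g) = ∑ i, c i • (gp i : G) := by
      simpa only [AddSubgroup.val_finsetSum, AddSubgroupClass.coe_zsmul] using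
        congrArg Subtype.val hc
    have hd' : u • (g - τ g) = ∑ j, d j • (gm j : G) := by
      simpa only [AddSubgroup.val_finsetSum, AddSubgroupClass.coe_zsmul] using
        congrArg Subtype.val hd
    rw [← hc', ← hd']
    linear_combination (norm := module) -(hu g)

end Literature.GroupTheory.FiniteAbelian
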